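import Summits.HodgeConjecture.HodgeConjecture.Theses.EndoscopicMiddleDegree

/-!
# Line `definite-twin-theta` — skeleton for crux `MiddleThetaSpan` (stmt-HodgeConjecture-13661)

Route `EndoscopicMiddleDegree`, crux `MiddleThetaSpan` (rank 2, the heart): for `m ∈ {1,2}`,
`n = m + 1`, `X` a compact arithmetic `2n`-ball quotient with datum `D`, every RATIONAL Hodge
`(n,n)`-class lies in `SCⁿ(D) ⊔ SCⁿ⁻¹(D)·Alg¹ ⊔ Hdg_ℚ^{n-1,n-1}·Alg¹`.

Idea `definite-twin-theta` (Cruxes/MiddleThetaSpan/Ideas/definite-twin-theta.md; triage r1-1: pass):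
prove the `a = 1` first-occurrence statement for the Tate-type packets `π = A(n,n) ⊗ π_f` by
passing to the 𝔮-twin `𝟙 ⊗ π'_f` on the DEFINITE inner form `U(V')` (TwinSignLemma), running
Rallis' programme there (first-term range `V' → W`, `dim W = 2n`; Rallis inner product formula +
Yamana's local–global criterion; archimedean factors = trivial rep of compact `U(2n+1)`), and coming
back `W → V` in Weil's convergent range (`V` anisotropic) with the Kudla–Millson vector at `τ₁`; then
BMM Prop. 70 / Thm. 71 (seesaw `W = W_{n-1,n-1} ⊕ W₂`, range-free) land the classes.

The automorphic middle of that chain (Matsushima decomposition of `H²ⁿ(X(ℂ))`, Arthur parameters of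
`U(V)`, theta correspondence, Kudla–Millson classes) has NO carrier in the tree today, so the typed
skeleton is the chain's GEOMETRIC SPINE — four closed statements over existing declarations from
which `MiddleThetaSpan_of` proves the crux by name (no `sorry` outside the four `stub_*`):

* `stub_thetaSupport` (HARDEST; the automorphic heart, in the fixed-level form the twin line
  delivers): every rational `(n,n)`-class is the sum of a `ℂ`-combination of RATIONAL `(n,n)`-classes
  SUPPORTED ON codimension-`(n-1)` special cycles `c(W)` and of a Hodge-decomposable class
  (`(n-1,n-1) ∪ (1,1)`). Content: Lefschetz split `c = c₀ + L c'`; sieve/core (rational primitive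
  ⟹ Tate-type pieces); TWIN THETA (Tate-type `π` is `θ_W(σ)`, `dim W = 2n`, KM vector at `τ₁`);
  BMM Prop. 70 (`W` split ⟹ `SCⁿ`, and `SCⁿ ≤` supported-on-`c(W')`, `W' ⊂ W`) / Thm. 71 (`W`
  non-split ⟹ products `θ_{n-1} ∧ θ_{1,1}` at deeper level, whose push-forwards are supported on
  `c(W')`), imprimitivity and Lefschetz-shift corrections in `L·H^{n-1,n-1}`.
* `stub_supportedDescent` (the per-level residue R1 / CAVEAT-13661, ISOLATED): a rational
  `(n,n)`-class supported on a codimension-`(n-1)` special cycle lies in the crux span. This is the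
  crux restricted to such classes (Deligne MHS + Lefschetz (1,1) on the sub-ball quotient `c(W)` +
  `NS(c(W)) = ι^*NS(X) + special divisors + ?`); its refutation refutes the crux as typed
  (misstated; repair = CAVEAT-13661 widening) while the other three stubs survive verbatim.
* `stub_oneOneAlgebraic`: on these `X` (`p = 2n ≥ 4`) EVERY `(1,1)`-class is a `ℂ`-combination of
  divisor classes (BMM Cor. 62 Remark, `p > 2`, + Lefschetz (1,1)).
* `stub_diagonalRational`: for `n ≤ 3`, `H^{n-1,n-1}(X(ℂ))` is spanned by rational classes (BMM
  Cor. 62 at `(a,b) = (n-1,n-1)`: `6(n-1) < 4n+2`; this is why `m ≤ 2`).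

Disproof used: none exists for this crux (payload.disproof_path absent on this hub, `ledger crux ls`
shows no Disproof.lean, 2026-08-16) — no `_false_without_` obstruction or landed Negative lemma to
honour; the refuter's crux-attack risks R1–R3 (item notes 20:16Z) are answered stub by stub in the
line card `Lines/definite-twin-theta.md`.
-/

namespace Summit.HodgeConjecture.HodgeConjecture.Cruxes.MiddleThetaSpan.DefiniteTwinTheta

open Literature.AlgebraicGeometry.Motives (SchemeOver)
open Literature.AlgebraicGeometry.HodgeTheory
open Literature.AlgebraicGeometry.ShimuraVarieties
open Literature.AlgebraicTopology.SingularHomology (cupProduct)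

/-- **stub_thetaSupport** (hardest; the automorphic heart of the line, fixed-level form).
For `m ∈ {1,2}`, `n = m+1`, every rational Hodge `(n,n)`-class on the `2n`-ball quotient `X` lies in
`span{u rational of type (n,n) supported on c(W), W totally positive definite, dim_E W = n-1}
 ⊔ span{y ∪ d : y of type (n-1,n-1), d of type (1,1)}`.
Informal proof (the twin line): Lefschetz split; rational primitive classes live in Tate-type
`π_f`-pieces (sieve + core); `A(n,n) ⊗ π_f ↔ 𝟙 ⊗ π'_f` on the definite twin `U(V')` (KMSW signs);
`θ_{V'→W}(π') ≠ 0` cuspidal (Rallis inner product formula, first-term range; Yamana); return lift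
`θ_{W→V}(σ) = A(n,n) ⊗ π_f` (Weil-convergent since `V` anisotropic; Howe duality, Sun–Zhu
conservation at 𝔮, Kudla–Millson `φ_{n,n}` at `τ₁`); BMM Prop. 70 / Thm. 71 seesaw
`W = W_{n-1,n-1} ⊕ W₂` at deeper level and push-forward (supported on `c(W')`); corrections in
`L · H^{n-1,n-1}`. -/
theorem stub_thetaSupport :
    ∀ (m : ℕ) (X : SchemeOver ℂ) (D : UnitaryBallQuotientDatum (2 * (m + 1)) X), 1 ≤ m → m ≤ 2 →
      ∀ c : complexBetti X (2 * (m + 1)), IsRationalClass c →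
        IsOfHodgeType (2 * (m + 1)) X (2 * (m + 1)) (m + 1) (m + 1) c →
        c ∈ Submodule.span ℂ {u : complexBetti X (2 * (m + 1)) |
              IsRationalClass u ∧ IsOfHodgeType (2 * (m + 1)) X (2 * (m + 1)) (m + 1) (m + 1) u ∧
              ∃ W : Submodule D.E (Fin (2 * (m + 1) + 1) → D.E),
                IsTotallyPositive (conjRingHom D.E) D.H W ∧ Module.finrank D.E W = m ∧
                u ∈ classesSupportedOn X (D.specialSubvariety W) (2 * (m + 1))}
          ⊔ Submodule.span ℂ {z : complexBetti X (2 * (m + 1)) |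
              ∃ y : complexBetti X (2 * m), IsOfHodgeType (2 * (m + 1)) X (2 * m) m m y ∧
              ∃ d : complexBetti X (2 * 1), IsOfHodgeType (2 * (m + 1)) X (2 * 1) 1 1 d ∧
              z = cupProduct (two_mul_add_two_mul m 1) y d} := by
  sorry

/-- **stub_supportedDescent** (the per-level residue R1 / CAVEAT-13661, isolated as a checkable
statement; an INSTANCE of the crux). For `m ∈ {1,2}`, `n = m+1`: a rational `(n,n)`-class `u`
supported on a codimension-`(n-1)` special cycle `c(W)` (`dim_E W = n-1`) lies in
`SCⁿ(D) ⊔ span{s ∪ d : s supported on the SAME c(W) in degree 2(n-1), d ∈ Alg¹}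
 ⊔ span{a ∪ d : a rational (n-1,n-1), d ∈ Alg¹}` (a sharpening of the crux span: the middle
summand only uses classes supported on `c(W)` itself, e.g. its own class `[c(W)]`).
Informal proof: `u = ι_* β`, `β ∈ H²(c̃(W); ℚ)` of type (1,1) (Deligne, strictness), a divisor class
on the sub-ball quotient `c(W) ≅ Γ_W \ 𝔹ⁿ⁺¹` (Lefschetz (1,1)); `ι_*(ι^* D) = [c(W)] ∪ D` (projection
formula) and `ι_*`(special divisor of `c(W)`) = special `n`-cycle of `X`; the bet (R1) is that
`NS(c(W))_ℚ` needs nothing else modulo classes with Hodge-decomposable push-forward. -/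
theorem stub_supportedDescent :
    ∀ (m : ℕ) (X : SchemeOver ℂ) (D : UnitaryBallQuotientDatum (2 * (m + 1)) X), 1 ≤ m → m ≤ 2 →
      ∀ u : complexBetti X (2 * (m + 1)), IsRationalClass u →
        IsOfHodgeType (2 * (m + 1)) X (2 * (m + 1)) (m + 1) (m + 1) u →
        ∀ W : Submodule D.E (Fin (2 * (m + 1) + 1) → D.E),
          IsTotallyPositive (conjRingHom D.E) D.H W → Module.finrank D.E W = m →
          u ∈ classesSupportedOn X (D.specialSubvariety W) (2 * (m + 1)) →
          u ∈ (⨆ (W' : Submodule D.E (Fin (2 * (m + 1) + 1) → D.E))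
                (_ : IsTotallyPositive (conjRingHom D.E) D.H W') (_ : Module.finrank D.E W' = m + 1),
                classesSupportedOn X (D.specialSubvariety W') (2 * (m + 1)))
            ⊔ Submodule.span ℂ {z : complexBetti X (2 * (m + 1)) |
                ∃ s ∈ classesSupportedOn X (D.specialSubvariety W) (2 * m),
                ∃ d ∈ algebraicClasses X 1, z = cupProduct (two_mul_add_two_mul m 1) s d}
            ⊔ Submodule.span ℂ {z : complexBetti X (2 * (m + 1)) |
                ∃ a : complexBetti X (2 * m), IsRationalClass a ∧
                  IsOfHodgeType (2 * (m + 1)) X (2 * m) m m a ∧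
                  ∃ d ∈ algebraicClasses X 1, z = cupProduct (two_mul_add_two_mul m 1) a d} := by
  sorry

/-- **stub_oneOneAlgebraic** (BMM Cor. 62 Remark + Lefschetz (1,1)). On a compact arithmetic
ball quotient of even dimension `p = 2(m+1) ≥ 4` EVERY class of Hodge type `(1,1)` in
`H²(X(ℂ); ℂ)` is a `ℂ`-linear combination of divisor classes: `H^{1,1}` is defined over `ℚ` for
`p > 2` (BMM Part 2 §1.9, Remark after Cor. 62 — false for `p = 2`, Blasius–Rogawski, whence
`1 ≤ m`) and rational `(1,1)`-classes are algebraic (Lefschetz). -/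
theorem stub_oneOneAlgebraic :
    ∀ (m : ℕ) (X : SchemeOver ℂ), 1 ≤ m → Nonempty (UnitaryBallQuotientDatum (2 * (m + 1)) X) →
      ∀ d : complexBetti X (2 * 1), IsOfHodgeType (2 * (m + 1)) X (2 * 1) 1 1 d →
        d ∈ algebraicClasses X 1 := by
  sorry

/-- **stub_diagonalRational** (BMM Cor. 62 at `(a,b) = (m,m)`, `q = 1`). For `m ∈ {1,2}` and `X` a
compact arithmetic `2(m+1)`-ball quotient, every class of Hodge type `(m,m)` in `H^{2m}(X(ℂ); ℂ)` is
a `ℂ`-linear combination of RATIONAL `(m,m)`-classes (`3(a+b)+|a-b| = 6m < 2(2m+3)` iff `m ≤ 2`: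
this is why the crux stops at `m = 2`). -/
theorem stub_diagonalRational :
    ∀ (m : ℕ) (X : SchemeOver ℂ), 1 ≤ m → m ≤ 2 →
      Nonempty (UnitaryBallQuotientDatum (2 * (m + 1)) X) →
      ∀ y : complexBetti X (2 * m), IsOfHodgeType (2 * (m + 1)) X (2 * m) m m y →
        y ∈ Submodule.span ℂ {a : complexBetti X (2 * m) |
              IsRationalClass a ∧ IsOfHodgeType (2 * (m + 1)) X (2 * m) m m a} := by
  sorry

/-- **Composition** (kernel-checked; no `sorry` of its own — `sorryAx` enters only through the four declared
stubs, used BY NAME): the stubs imply the crux `EndoscopicMiddleDegree.MiddleThetaSpan`, concluded by name.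
Supported rational `(n,n)`-classes go to the crux span by `stub_supportedDescent` (its middle summand, classes
supported on the same `c(W)`, is enlarged to `SCⁿ⁻¹(D) ∪ Alg¹`); a decomposable `y ∪ d` goes to the third
summand after writing `y` as a combination of rational `(m,m)`-classes (`stub_diagonalRational`) and `d` as a
combination of divisor classes (`stub_oneOneAlgebraic`), by bilinearity of the cup product. -/
theorem MiddleThetaSpan_of :
    Summit.HodgeConjecture.HodgeConjecture.Theses.EndoscopicMiddleDegree.MiddleThetaSpan := by
  intro m X D h1 h2 c hc hcH
  have hc' := stub_thetaSupport m X D h1 h2 c hc hcH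
  refine (sup_le ?_ ?_ :
    Submodule.span ℂ {u : complexBetti X (2 * (m + 1)) |
          IsRationalClass u ∧ IsOfHodgeType (2 * (m + 1)) X (2 * (m + 1)) (m + 1) (m + 1) u ∧
          ∃ W : Submodule D.E (Fin (2 * (m + 1) + 1) → D.E),
            IsTotallyPositive (conjRingHom D.E) D.H W ∧ Module.finrank D.E W = m ∧
            u ∈ classesSupportedOn X (D.specialSubvariety W) (2 * (m + 1))}
      ⊔ Submodule.span ℂ {z : complexBetti X (2 * (m + 1)) |
          ∃ y : complexBetti X (2 * m), IsOfHodgeType (2 * (m + 1)) X (2 * m) m m y ∧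
          ∃ d : complexBetti X (2 * 1), IsOfHodgeType (2 * (m + 1)) X (2 * 1) 1 1 d ∧
          z = cupProduct (two_mul_add_two_mul m 1) y d} ≤ _) hc'
  · -- rational (n,n)-classes supported on codimension-(n-1) special cycles: `stub_supportedDescent`,
    -- then enlarge its middle summand (classes supported on this `c(W)`) to `SCⁿ⁻¹(D) ∪ Alg¹`
    refine Submodule.span_le.2 ?_
    rintro u ⟨hu, huH, W, hW, hWk, huW⟩
    have hu' := stub_supportedDescent m X D h1 h2 u hu huH W hW hWk huW
    have hBW : Submodule.span ℂ {z : complexBetti X (2 * (m + 1)) |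
          ∃ s ∈ classesSupportedOn X (D.specialSubvariety W) (2 * m),
          ∃ d ∈ algebraicClasses X 1, z = cupProduct (two_mul_add_two_mul m 1) s d} ≤
        Submodule.span ℂ {z : complexBetti X (2 * (m + 1)) |
          ∃ s ∈ (⨆ (W : Submodule D.E (Fin (2 * (m + 1) + 1) → D.E))
            (_ : IsTotallyPositive (conjRingHom D.E) D.H W) (_ : Module.finrank D.E W = m),
            classesSupportedOn X (D.specialSubvariety W) (2 * m)),
          ∃ d ∈ algebraicClasses X 1, z = cupProduct (two_mul_add_two_mul m 1) s d} := by
      refine Submodule.span_mono ?_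
      rintro z ⟨s, hs, d, hd, hz⟩
      exact ⟨s, Submodule.mem_iSup_of_mem W (Submodule.mem_iSup_of_mem hW
        (Submodule.mem_iSup_of_mem hWk hs)), d, hd, hz⟩
    exact (sup_le_sup (sup_le_sup_left hBW _) le_rfl) hu'
  · -- Hodge-decomposable classes `y ∪ d`: rationalise `y`, make `d` algebraic, use bilinearity
    refine Submodule.span_le.2 ?_
    rintro z ⟨y, hy, d, hd, rfl⟩
    have hdA : d ∈ algebraicClasses X 1 := stub_oneOneAlgebraic m X h1 ⟨D⟩ d hd
    have hy' := stub_diagonalRational m X h1 h2 ⟨D⟩ y hy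
    refine Submodule.mem_sup_right ?_
    have key : Submodule.span ℂ {a : complexBetti X (2 * m) |
          IsRationalClass a ∧ IsOfHodgeType (2 * (m + 1)) X (2 * m) m m a} ≤
        (Submodule.span ℂ {z : complexBetti X (2 * (m + 1)) |
            ∃ a : complexBetti X (2 * m), IsRationalClass a ∧
              IsOfHodgeType (2 * (m + 1)) X (2 * m) m m a ∧
              ∃ d ∈ algebraicClasses X 1, z = cupProduct (two_mul_add_two_mul m 1) a d}).comap
          ((cupProduct (two_mul_add_two_mul m 1)).flip d) := by
      refine Submodule.span_le.2 ?_
      intro a ha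
      rw [SetLike.mem_coe, Submodule.mem_comap, LinearMap.flip_apply]
      exact Submodule.subset_span ⟨a, ha.1, ha.2, d, hdA, rfl⟩
    have hyd := key hy'
    rw [Submodule.mem_comap, LinearMap.flip_apply] at hyd
    exact hyd

end Summit.HodgeConjecture.HodgeConjecture.Cruxes.MiddleThetaSpan.DefiniteTwinTheta
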